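import Mathlib.Analysis.Complex.Basic
import Mathlib.Analysis.SpecialFunctions.Pow.Real
import HarnessLib

/-!
# A solution is controlled by a flux-carrying solution, its conjugate, and the Wronskian

Topic `Literature/Analysis/ODE` (namespace `Literature.Analysis.ODE`). Pointwise algebra behind the
representation `u = A v + B v̄` of a solution of a REAL second-order equation in the basis formed by a
complex solution `v` with non-zero flux `F_v = Im(v̄ v′)` and its conjugate. At a point, with the
values `u, u₁ = u′, v, v₁ = v′`, the Wronskians `W = u v₁ − v u₁`, `W̃ = u v̄₁ − v̄ u₁` and the fluxes
`F_u = Im(ū u₁)`, `F_v = Im(v̄ v₁)`: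

* `mul_conjWronskian_eq` — `u·(v v̄₁ − v̄ v₁) = v·W̃ − v̄·W` and `v v̄₁ − v̄ v₁ = −2i F_v`;
* `normSq_conjWronskian_eq` — the Lagrange identity `|W̃|² = |W|² + 4F_uF_v`;
* `norm_le_of_conj_pair` — hence `|u| ≤ |v|·(|W| + √|F_uF_v|)/|F_v|`.

Along solutions `W`, `W̃`, `F_u`, `F_v` are constants, so this bounds `|u|` by `|v|` everywhere once the
Wronskian and the fluxes are known: the far-zone control of the horizon-normalised solution of
Carter's equation by the infinity-normalised one in the threshold sliver (where the simpler
one-sided pairing of the threshold case fails because `F_u = −σ ≠ 0` may have the sign of `−F_v`).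
Near-extremal Kerr programme, crux `KappaExplicitWaveDecay`. Elementary; all proved.

## References
* P. Hartman, *Ordinary Differential Equations* (SIAM Classics 38, 2002), Ch. XI §2 (Wronskian,
  Lagrange identity). Key `Hartman2002`.
-/

noncomputable section

open scoped ComplexConjugate

namespace Literature.Analysis.ODE

/-- `u·(v v̄₁ − v̄ v₁) = v·(u v̄₁ − v̄ u₁) − v̄·(u v₁ − v u₁)` and `v v̄₁ − v̄ v₁ = −2i·Im(v̄ v₁)`.
[cite: Hartman2002, Ch. XI §2] -/
theorem mul_conjWronskian_eq (u u₁ v v₁ : ℂ) :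
    u * (v * conj v₁ - conj v * v₁) = v * (u * conj v₁ - conj v * u₁) - conj v * (u * v₁ - v * u₁) ∧
    v * conj v₁ - conj v * v₁ = -(2 * Complex.I * ((conj v * v₁).im : ℂ)) := by
  refine ⟨by ring, ?_⟩
  apply Complex.ext
  · simp
  · simp; ring

/-- **Lagrange identity**: `|u v̄₁ − v̄ u₁|² = |u v₁ − v u₁|² + 4·Im(ū u₁)·Im(v̄ v₁)`.
[cite: Hartman2002, Ch. XI §2] -/
theorem normSq_conjWronskian_eq (u u₁ v v₁ : ℂ) :
    ‖u * conj v₁ - conj v * u₁‖ ^ 2 =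
      ‖u * v₁ - v * u₁‖ ^ 2 + 4 * (conj u * u₁).im * (conj v * v₁).im := by
  rw [Complex.sq_norm, Complex.sq_norm, Complex.normSq_apply, Complex.normSq_apply]
  simp only [Complex.sub_re, Complex.sub_im, Complex.mul_re, Complex.mul_im, Complex.conj_re,
    Complex.conj_im]
  ring

/-- **Control of a solution by a flux-carrying one and the Wronskian.** If `Im(v̄ v₁) = F_v ≠ 0` and
`Im(ū u₁) = F_u`, then `|u| ≤ |v|·(|u v₁ − v u₁| + √|F_uF_v|)/|F_v|`. [folklore] -/
theorem norm_le_of_conj_pair {u u₁ v v₁ : ℂ} {Fu Fv : ℝ} (hFu : (conj u * u₁).im = Fu)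
    (hFv : (conj v * v₁).im = Fv) (hFv0 : Fv ≠ 0) :
    ‖u‖ ≤ ‖v‖ * (‖u * v₁ - v * u₁‖ + Real.sqrt |Fu * Fv|) / |Fv| := by
  obtain ⟨hid, hc⟩ := mul_conjWronskian_eq u u₁ v v₁
  have hlag := normSq_conjWronskian_eq u u₁ v v₁
  rw [hFu, hFv] at hlag
  rw [hFv] at hc
  have hFa : 0 < |Fv| := abs_pos.2 hFv0
  set W := u * v₁ - v * u₁ with hW
  set Wt := u * conj v₁ - conj v * u₁ with hWt
  -- `|v v̄₁ − v̄ v₁| = 2|F_v|`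
  have hnc : ‖v * conj v₁ - conj v * v₁‖ = 2 * |Fv| := by
    rw [hc, norm_neg, norm_mul, norm_mul, Complex.norm_I, mul_one, Complex.norm_real,
      Real.norm_eq_abs, Complex.norm_ofNat]
  -- `|W̃| ≤ |W| + 2√|F_uF_v|`
  have hWt_le : ‖Wt‖ ≤ ‖W‖ + 2 * Real.sqrt |Fu * Fv| := by
    have h1 : ‖Wt‖ ^ 2 ≤ (‖W‖ + 2 * Real.sqrt |Fu * Fv|) ^ 2 := by
      rw [hlag]
      have hs := Real.sq_sqrt (abs_nonneg (Fu * Fv))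
      have hle : Fu * Fv ≤ |Fu * Fv| := le_abs_self _
      nlinarith [hs, hle, norm_nonneg W, Real.sqrt_nonneg |Fu * Fv|]
    exact (pow_le_pow_iff_left₀ (norm_nonneg _) (by positivity) two_ne_zero).1 h1
  -- `2|F_v||u| ≤ |v|(|W̃| + |W|)`
  have hmain : ‖u‖ * (2 * |Fv|) ≤ ‖v‖ * (‖Wt‖ + ‖W‖) := by
    have h := congrArg (fun z ↦ ‖z‖) hid
    rw [norm_mul, hnc] at h
    rw [h]
    calc ‖v * Wt - conj v * W‖ ≤ ‖v * Wt‖ + ‖conj v * W‖ := norm_sub_le _ _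
      _ = ‖v‖ * (‖Wt‖ + ‖W‖) := by rw [norm_mul, norm_mul, Complex.norm_conj]; ring
  rw [le_div_iff₀ hFa]
  have hv0 : 0 ≤ ‖v‖ := norm_nonneg v
  have : ‖v‖ * (‖Wt‖ + ‖W‖) ≤ ‖v‖ * (2 * ‖W‖ + 2 * Real.sqrt |Fu * Fv|) :=
    mul_le_mul_of_nonneg_left (by linarith) hv0
  nlinarith [hmain, this]

end Literature.Analysis.ODE

end
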